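/-
Copyright: h21 programme. Stub-ideation companion (k = 2, GENERATION 3) — NOT a route file, NOT a
Theorems file. Elaboration sanity only: helper SIGNATURES with `sorry`.
-/
import HarnessLib
import Literature.NumberTheory.Automorphic.CDTTheorem712
import Literature.NumberTheory.EllipticCurves.ModFiveCongruenceHesseFamily
import Literature.NumberTheory.EllipticCurves.ModThreeReducibleIffPsi3Root
import Literature.NumberTheory.EllipticCurves.TorsionFrobenius
import Literature.NumberTheory.EllipticCurves.SemistableModPImageReducibleProofs
import Literature.NumberTheory.EllipticCurves.TateCurve.NumberFieldUniformizationTwistedTateJ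
import Literature.NumberTheory.GaloisRepresentations.DecompositionGroupOfCompletion
import Literature.NumberTheory.DiophantineGeometry.MinimalDiscriminant

/-!
# Stub-ideation k = 2, GENERATION 3 (HOME FAMILY 2 — RESHAPE) for `stub_switch` of crux `FreyModularity`

Companion to `STUB-IDEAS-stub_switch-2.md` (gen 3, supersedes gen 2).  Only the helpers that are NEW
or RE-CUT in generation 3 are typed here; the unchanged gen-2 helpers (G1, G2, C2, L1, L4, R1–R5, F1,
the reshaped target `CuspForcedSource` and the PROVED glue `stubSwitch_of_cuspForcedSource`) live in
`STUB_IDEAS_stub_switch_2_Sketch.lean` (namespace `…StubSwitchIdeas2G2`) and are cited by name.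

GEN-3 RE-CUT (NONSPLIT-CUSP FORCING, general `W`, no hypothesis at `3` used):
* C1 is no longer a free-standing "cusp splitting" claim: it is Fisher's **Theorem 12.2 (n = 5)**
  (`FisherSyzygeticPentagon`, a citable named fact: the syzygetic pentagons sit at
  `(λ:μ) = (ξ_T : 3)`, `ξ_T = (1+ζ+ζ⁴)x_T + (1+ζ²+ζ³)x_{2T}`, and `∂𝔇/∂λ(ξ_T,3) = −4 η_T²`)
  plus Frobenius bookkeeping (`helper_cuspSplitting_of_fisher`).
* the nonsplit sign is handled by ONE twisted-Tate dictionary lemma (`helper_frob_add_one_sq_three`):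
  the sign `ε(φ)` of the twisted uniformisation is READ on `E[5]` (where `φ = −1`) and APPLIED on
  `E[3]`, giving `(φ + 1)² = 0` on `E[3]`; no `HasSplitMultiplicativeReductionAt` predicate, no Tate
  line at level `15` (gen-2 L2/L3 dropped; L3 is now the tree's PROVED
  `exists_transvection_geomTorsion_of_hasMultiplicativeReductionAt_of_not_dvd`).
-/

set_option linter.dupNamespace false
set_option linter.unusedVariables false

noncomputable section

open scoped NumberField
open Literature.NumberTheory.EllipticCurves Literature.NumberTheory.EllipticCurves.HesseFamilyFive
open Literature.NumberTheory.Automorphic Literature.NumberTheory.GaloisRepresentations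
open Literature.NumberTheory.Automorphic.BCDT WeierstrassCurve Field NumberField IsDedekindDomain Matrix

namespace Summit.ABC.ABC.Cruxes.FreyModularity.StubSwitchK2G3

/-- Member `E_{l,m}` of Fisher's direct `5`-congruence family of `y² = x³ − 27c₄x − 54c₆`. -/
abbrev member (c₄ c₆ l m : ℚ) : WeierstrassCurve ℚ :=
  ⟨0, 0, 0, -27 * C4 c₄ c₆ l m, -54 * C6 c₄ c₆ l m⟩

/-- The `c₄c₆`-model (= the member at `(l:m) = (1:0)`), Fisher's Jacobian normalisation in Thm 12.2. -/
abbrev base (c₄ c₆ : ℚ) : WeierstrassCurve ℚ := ⟨0, 0, 0, -27 * c₄, -54 * c₆⟩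

/-! ## (F_cusp) the named fact — Fisher, *The Hessian of a genus one curve*, Thm 12.2, case `n = 5` -/

/-- **[Fisher2012Hessian, Thm. 12.2 (n = 5), PLMS 104 (2012) = arXiv:math/0610403 p.17] as a `Prop`
(candidate Literature named fact, statement-only).**  For the Jacobian normalisation
`E : y² = x³ − 27c₄x − 54c₆` and a point `T = (x₁,y₁)` of order `5` on `E(ℚ̄)` with `2T = (x₂,y₂)`,
and `ζ` a primitive `5`-th root of unity, put `ξ_T = (1+ζ+ζ⁴)x₁ + (1+ζ²+ζ³)x₂` and
`η_T = (x₁−x₂)⁴((ζ−ζ⁴)⁵y₁ + (ζ²−ζ³)⁵y₂)`.  Then `𝔇(ξ_T, 3) = 0` ("a calculation using division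
polynomials") and `∂𝔇/∂λ(ξ_T, 3) = −4η_T²` (from `H(ψ) = (1/(3·deg 𝔇))·∂𝔇/∂λ(ξ_T,3)·ψ = −(η_T/3)²ψ`,
`deg 𝔇 = 12`).  Both are polynomial identities modulo the `5`-division ideal, i.e. kernel-certifiable. -/
def FisherSyzygeticPentagon : Prop :=
  ∀ (c₄ c₆ : ℚ) (ζ x₁ y₁ x₂ y₂ : AlgebraicClosure ℚ)
    (h₁ : ((base c₄ c₆).baseChange (AlgebraicClosure ℚ)).toAffine.Nonsingular x₁ y₁)
    (h₂ : ((base c₄ c₆).baseChange (AlgebraicClosure ℚ)).toAffine.Nonsingular x₂ y₂)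
    (T : (base c₄ c₆).geomTorsion 5),
    c₄ ^ 3 ≠ c₆ ^ 2 → IsPrimitiveRoot ζ 5 →
    (T : geomPoints (base c₄ c₆)) = Affine.Point.some x₁ y₁ h₁ →
    ((T + T : (base c₄ c₆).geomTorsion 5) : geomPoints (base c₄ c₆)) = Affine.Point.some x₂ y₂ h₂ →
    D (algebraMap ℚ (AlgebraicClosure ℚ) c₄) (algebraMap ℚ (AlgebraicClosure ℚ) c₆)
        ((1 + ζ + ζ ^ 4) * x₁ + (1 + ζ ^ 2 + ζ ^ 3) * x₂) 3 = 0 ∧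
    Dl (algebraMap ℚ (AlgebraicClosure ℚ) c₄) (algebraMap ℚ (AlgebraicClosure ℚ) c₆)
        ((1 + ζ + ζ ^ 4) * x₁ + (1 + ζ ^ 2 + ζ ^ 3) * x₂) 3 =
      -4 * ((x₁ - x₂) ^ 4 * ((ζ - ζ ^ 4) ^ 5 * y₁ + (ζ ^ 2 - ζ ^ 3) ^ 5 * y₂)) ^ 2

/-! ## (C) cusp root mod `q` from the named fact (replaces gen-2 `helper_cuspSplitting`'s free claim) -/

/-- **C1b (S, the arithmetic heart of simplicity): `η_T` and `η_{2T}` cannot both vanish mod `𝔓 ∤ 10`.**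
With `a = (ζ−ζ⁴)⁵`, `b = (ζ²−ζ³)⁵`: `η_T = c(a y_T + b y_{2T})`, `η_{2T} = c(a y_{2T} − b y_T)`
(`x_{4T} = x_T`, `y_{4T} = −y_T`), and the determinant `a² + b² = u⁵ + ū⁵` with `u + ū = −5`,
`uū = 5` (`u = (ζ−ζ⁴)² = ζ²+ζ³−2`) equals `−625 = −5⁴`.  Ring identity in `ℤ[ζ]/Φ₅`. -/
theorem helper_eta_determinant {R : Type*} [CommRing R] (ζ : R)
    (hζ : 1 + ζ + ζ ^ 2 + ζ ^ 3 + ζ ^ 4 = 0) :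
    ((ζ - ζ ^ 4) ^ 5) ^ 2 + ((ζ ^ 2 - ζ ^ 3) ^ 5) ^ 2 = -625 := by
  sorry

/-- **C1 = C1a `helper_cuspSplitting_of_fisher` (M): Frobenius `= −1` on `E[5]` ⇒ a SIMPLE root of
`𝔇_E(λ,1)` mod `q`.**  Proof plan: `T ∈ E[5]∖0`; `φ` fixes `ζ₅` (`q ≡ 1 (5)`,
`IsArithFrobAt.apply_of_pow_eq_one`) and maps `T ↦ −T`, `2T ↦ −2T`, so fixes `x_T, x_{2T}` and
`η_T²`: `ξ_T, η_T² ∈ ℚ̄^{φ}`; they are `𝔓`-integral (`q ∤ 30(c₄³−c₆²)`: `x_T` is a root of the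
`5`-division polynomial whose leading coefficient is `5`), hence reduce to `𝔽_q`
(arithmetic Frobenius: `φ a ≡ a^q (mod 𝔓)`); `3` is a unit, so `r̄ = ξ_T/3 mod 𝔓 ∈ 𝔽_q` is a root of
`𝔇(λ,1)` (homogeneity, degree `12`), simple for `T` or for `2T` by `FisherSyzygeticPentagon.2`,
`helper_eta_determinant` and `ȳ_T ≠ 0`, `x̄_T ≠ x̄_{2T}` (injective reduction of `E[5]`, `q ∤ 10Δ`);
lift `r̄` to `r : ℤ`. -/
theorem helper_cuspSplitting_of_fisher (hF : FisherSyzygeticPentagon) (c₄ c₆ : ℤ)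
    (hΔ : c₄ ^ 3 ≠ c₆ ^ 2) [hE : (base (c₄ : ℚ) (c₆ : ℚ)).IsElliptic]
    {q : ℕ} (hq : q.Prime) (hq30 : ¬ (q : ℤ) ∣ 30 * (c₄ ^ 3 - c₆ ^ 2)) (hq5 : q % 5 = 1)
    {v : HeightOneSpectrum (𝓞 ℚ)} (hv : (Rat.HeightOneSpectrum.primesEquiv v : ℕ) = q)
    {𝔓 : Ideal (absIntegers (𝓞 ℚ) ℚ)} (h𝔓 : 𝔓 ∈ v.primesAbove)
    {φ : absoluteGaloisGroup ℚ} (hφ : IsArithFrobAt (𝓞 ℚ) φ 𝔓)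
    (hneg : ∀ P : (base (c₄ : ℚ) (c₆ : ℚ)).geomTorsion 5, φ • P = -P) :
    ∃ r : ℤ, (q : ℤ) ∣ D c₄ c₆ r 1 ∧ ¬ (q : ℤ) ∣ Dl c₄ c₆ r 1 := by
  sorry

/-! ## (G3) the Chebotarev prime is `≡ 1 (mod m)` -/

/-- **G3 `helper_prime_mod_eq_one` (S): an arithmetic Frobenius at `𝔓 ∣ q ∤ m` with `χ̄_m(φ) = 1`
forces `q ≡ 1 (mod m)`** (`χ̄_m(Frob_𝔓) = q`: `IsArithFrobAt.apply_of_pow_eq_one` on a primitive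
`m`-th root of unity + injectivity of `μ_m → μ_m(𝔽̄_q)` for `q ∤ m`; or the tree's local
`coe_modNCyclotomicCharacter_absGaloisRestrict_of_isAbsArithFrob` moved to `Γ_ℚ` by
`decompositionSubgroup_adicCompletionPrime_eq_range`). -/
theorem helper_prime_mod_eq_one (m : ℕ) [NeZero m] {q : ℕ} (hq : q.Prime) (hqm : ¬ q ∣ m)
    {v : HeightOneSpectrum (𝓞 ℚ)} (hv : (Rat.HeightOneSpectrum.primesEquiv v : ℕ) = q)
    {𝔓 : Ideal (absIntegers (𝓞 ℚ) ℚ)} (h𝔓 : 𝔓 ∈ v.primesAbove)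
    {φ : absoluteGaloisGroup ℚ} (hφ : IsArithFrobAt (𝓞 ℚ) φ 𝔓)
    (h1 : modNCyclotomicCharacter ℚ m φ = 1) : q % m = 1 := by
  sorry

/-! ## (N) the twisted-Tate dictionary: read the sign on `E[5]`, apply it on `E[3]` -/

/-- **N1 `helper_frob_add_one_sq_three` (M — the load-bearing NEW helper).**  `E/ℚ` multiplicative at
`v ∣ q`, `q ≡ 1 (mod 15)`, `φ` an arithmetic Frobenius at `𝔓 ∣ q` acting as `−1` on `E[5]`.  Then
`(φ + 1)² = 0` on `E[3]`.  Proof plan: conjugate `𝔓` to `adicCompletionPrime v`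
(`exists_smul_eq_of_mem_primesAbove_holds`; `−1` and the conclusion are conjugation-stable), so
`φ ∈ D_𝔓 = range (resGal)` (`decompositionSubgroup_adicCompletionPrime_eq_range`), `φ = res φₗ`;
take the twisted uniformisation `Ψ` at `v` (`exists_twistedTateUniformisation_tateJ`, PROVED):
`σ • Ψ(u) = ε(σ) Ψ(σ u)`.  `φₗ` fixes `ζ₁₅` (`q ≡ 1 (15)`), so on `Ψ(ζ₅) ≠ 0` (order `5`):
`−Ψ(ζ₅) = φ • Ψ(ζ₅) = ε(φₗ) Ψ(ζ₅)`, whence `ε(φₗ) = −1`; on `E[3] = Ψ{u : u³ ∈ q^ℤ μ₃}`: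
`φₗ u = ζ₃^κ u`, so `(φ + 1) Ψ(u) = Ψ(u) − Ψ(ζ₃^κ u) ∈ Ψ(μ₃)` and `(φ + 1) Ψ(μ₃) = 0`.
Transport `E(ℚ̄)[n] ≅ E(ℚ̄_q)[n]` by `exists_pointsMapOfEmb_eq_of_nsmul_eq_zero` / `pointsMapOfEmb_smul`
(pattern: tree `exists_transvection_geomTorsion_of_hasMultiplicativeReductionAt_of_not_dvd`). -/
theorem helper_frob_add_one_sq_three (E : WeierstrassCurve ℚ) [E.IsElliptic] {q : ℕ} (hq : q.Prime)
    (hq15 : q % 15 = 1) {v : HeightOneSpectrum (𝓞 ℚ)}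
    (hv : (Rat.HeightOneSpectrum.primesEquiv v : ℕ) = q) (hmult : E.HasMultiplicativeReductionAt v)
    {𝔓 : Ideal (absIntegers (𝓞 ℚ) ℚ)} (h𝔓 : 𝔓 ∈ v.primesAbove)
    {φ : absoluteGaloisGroup ℚ} (hφ : IsArithFrobAt (𝓞 ℚ) φ 𝔓)
    (hneg : ∀ P : E.geomTorsion 5, φ • P = -P) :
    ∀ Q : E.geomTorsion 3, φ • (φ • Q + Q) + (φ • Q + Q) = 0 := by
  sorry

/-- **FIN2 `helper_neg_on_line_of_add_one_sq` (S, linear algebra over `𝔽₃`): if `(φ+1)² = 0` on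
`E[3]` then `φ` acts as `−1` on every `φ`-stable line** (`φ • P = k • P`, `k = 1` would give
`(φ+1)²P = 4P = P ≠ 0`). -/
theorem helper_neg_on_line_of_add_one_sq (E : WeierstrassCurve ℚ) [E.IsElliptic]
    {φ : absoluteGaloisGroup ℚ} (hφ : ∀ Q : E.geomTorsion 3, φ • (φ • Q + Q) + (φ • Q + Q) = 0)
    {P : E.geomTorsion 3} (hP0 : P ≠ 0) (hst : φ • P ∈ AddSubgroup.zmultiples P) :
    φ • P = -P := by
  sorry

/-- **R-contradiction (S): the character of a stable line takes the value `−1` at `φ`** — so gen-2 R4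
(`helper_quadratic_character_cyclotomic`: the character is `1` at any `σ` with `χ̄_M(σ) = 1`) closes
the reducible case.  Stated over the tree's character interface (`Mazur1978.exists_isogenyCharacter`). -/
theorem helper_character_neg_one (E : WeierstrassCurve ℚ) [E.IsElliptic] [Fact (Nat.Prime 3)]
    {P : E.geomTorsion 3} (hP0 : P ≠ 0) {r : absoluteGaloisGroup ℚ →* (ZMod 3)ˣ}
    (hr : ∀ σ : absoluteGaloisGroup ℚ, σ • P = ((r σ : (ZMod 3)ˣ) : ZMod 3).val • P)
    {φ : absoluteGaloisGroup ℚ} (hφ : φ • P = -P) : r φ = -1 := by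
  sorry

end Summit.ABC.ABC.Cruxes.FreyModularity.StubSwitchK2G3
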